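import Summits.QuantumFields.YangMills.Theorems.UnitScaleTiltProp7SmoothUntwistKUniform
import HarnessLib

/-!
# Route `UnitScaleTilt`, crux K1 «MinimiserStabilityRegPr» (stmt-QuantumFields-19200), route-R E′ path (α′), (E1) «pinned slice theorem» — its STARTING POINT (row R2 ∕ (F1′)):
# THE SMOOTH UNTWISTED CHART IN THE KNIT'S SOCKET CURRENCY — `Pi` sup norms: `ℓ·‖D‴‖ ≤ s₀ + (1+2s₀)(1+6σ)K₁` and `ℓ²·‖divB 𝒰 D‴‖ ≤ s₁′ + 3(K₂ + 9K₁² + 36σK₂) + 3(6K₁s₀ + 4s₀(1+6σ)K₁)`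
# from print's rows `ℓ·‖A₀‖ ≤ s₀` ((1.36)₁), `ℓ²·‖divB 𝒰 A₀‖ ≤ s₁′` ((1.36)₂), `dist1(u(c_y)) ≤ σ` ((1.72)) — so the (E1) data row `hD : q D‴ ≤ s_*` is ONE `max_le`

Cell `ym3-torus`, width seat `ym-ust-19200-w1` (gen 12); LOCATE `LOCATE-F1PRIME-SMOOTH-UNTWIST-w1g12.md` (19200 evidence n = 55), file (U5) — the socket reading of ✓
`Prop7SmoothUntwistKUniform.exists_smoothUntwistedChart_kUniform_T3` (U4).  THEOREMS ONLY (0 `def`, 0 `sorry`); `--supports stmt-QuantumFields-19200`, count-neutral.  YM₃ on T³ is a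
ladder rung (R3), not the Clay problem; nothing here claims a stub, the crux, d = 4 or the mass gap; (E1) is NOT closed by this file.

WHY.  The (E1-e) knit measures bond fields `A : Fin d → Site → M₂(ℂ)` by `q A = max(ℓ·‖A‖, ℓ²·‖fun x => divB 𝒰 A x‖)` in the `Pi` (sup) norms (✓ `Prop7ExactCorrectorContractionGauge`,
✓ `Prop7LinearCorrectorBound.linCorr_gauge_le_of_rows`'s `hq`, ✓ `Prop7GaugeRowsMaxSup`), and print's rows for the Landau field `A₀ = ηA` are sup rows too.  THIS FILE converts
(U4)'s pointwise rows into exactly that currency: inputs `ℓ·‖fun μ z => A₀ ⟨z,μ⟩‖ ≤ s₀ ≤ 1∕64`, `ℓ²·‖fun x => divB 𝒰 A₀ x‖ ≤ s₁′`, `σ ≤ 1∕1024`, frame constants `c₀ c₁` (`ℓa₀ ≤ c₀`,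
`ℓ²a₁ ≤ c₁`; `= C′e^{C′}` by ✓ `exists_smoothUntwistedChart_of_regPr_T3`), window `K₁ ≤ 1∕256`; outputs the two `Pi`-norm rows of `D‴`, Hermitian-tracelessness, the action and
the fibre membership.

WHAT IS PROVED (ns `…Theorems.Prop7SmoothUntwistSocket`).
* `pi_norm_bond_le_iff`, `norm_bond_le_of_pi` — `Pi`-norm ⟷ pointwise for `Fin d → Site → M₂(ℂ)` and `Site → M₂(ℂ)`.
* ★★★ `exists_smoothUntwistedChart_socket_T3` — the statement of the title.
HONEST SCOPE.  Sup-norm bookkeeping over (U4); displayed: frames (`hFr hFr1 hA`, `c₀ c₁`), `s₀ s₁′ σ`; the contraction window of (E1) is not discussed.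

References: T. Bałaban, CMP 99 (1985) 75–102 [Balaban1985RegularSpaces] ((1.36) p.82, (1.72) p.88); CMP 102 (1985) 277–309 [Balaban1985Variational] (Prop. 7 p.299, (15) p.280);
CMP 99 (1985) 389–434 [Balaban1985BackgroundPropagators] ((3.8) p.392, (3.35) p.396).
-/

set_option autoImplicit false

noncomputable section

open scoped BigOperators Matrix.Norms.L2Operator

namespace Summit.QuantumFields.YangMills.Theorems.Prop7SmoothUntwistSocket

open Literature.MathematicalPhysics.QuantumFieldTheory.Balaban1983to89
open Literature.MathematicalPhysics.QuantumFieldTheory.Balaban1983to89.T3ContinuumYM3Torus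
open Literature.MathematicalPhysics.QuantumFieldTheory.Balaban1983to89.T3PrintedRegularMinimiser (regFibrePr)
open Literature.MathematicalPhysics.QuantumFieldTheory.Balaban1983to89.T3SectALandauChart (emb15)
open T4Continuum
open B9Eq39Adjoint (divB)
open B9TorusCalculus (torusT)
open B10Eq27TorusAxialLog (unitsField toUField)
open B5Eq118OneStroke (iterBlockOf)
open B15DeterminingSets (embIter)
open Summit.QuantumFields.YangMills.Theorems.Prop7TPrint (expHermField)
open Summit.QuantumFields.YangMills.Theorems.Prop7SmoothUntwistKUniform (exists_smoothUntwistedChart_kUniform_T3)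

/-! ## §1 `Pi`-norm bookkeeping -/

section PiNorm

variable {P : Params} {j : ℕ}

/-- `‖A‖ ≤ r` for a bond field `A : Fin d → Site → M₂(ℂ)` in the `Pi` norm iff `‖A μ z‖ ≤ r` for all `μ z` (`0 ≤ r`). [folklore] -/
theorem pi_norm_bond_le_iff (A : Fin P.d → Site P j → Matrix (Fin 2) (Fin 2) ℂ) {r : ℝ} (hr : 0 ≤ r) : ‖A‖ ≤ r ↔ ∀ μ z, ‖A μ z‖ ≤ r := by
  rw [pi_norm_le_iff_of_nonneg hr]
  exact ⟨fun h μ z => (pi_norm_le_iff_of_nonneg hr).1 (h μ) z, fun h μ => (pi_norm_le_iff_of_nonneg hr).2 (h μ)⟩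

/-- pointwise from `Pi`: `‖A μ z‖ ≤ ‖A‖`. [folklore] -/
theorem norm_bond_le_of_pi (A : Fin P.d → Site P j → Matrix (Fin 2) (Fin 2) ℂ) (μ : Fin P.d) (z : Site P j) : ‖A μ z‖ ≤ ‖A‖ :=
  (norm_le_pi_norm (A μ) z).trans (norm_le_pi_norm A μ)

end PiNorm

/-! ## §2 The socket -/

section Socket

/-- ★★★ **THE SMOOTH UNTWISTED CHART, SOCKET CURRENCY (`Pi` sup norms).**  T³ run `F.P K`, `1 ≤ K − n`, `ℓ = L^{K−n}`; background `W`; Landau field `A₀` Hermitian-traceless with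
print's rows `ℓ·‖fun μ z => A₀ ⟨z,μ⟩‖ ≤ s₀ ≤ 1∕64`, `ℓ²·‖fun x => divB 𝒰 (fun μ z => A₀ ⟨z,μ⟩) x‖ ≤ s₁′`; twist `u` with `(e^{iA₀}W)^u ∈ (6)(e) ∩ 𝔅_k(V)`, `dist1(u(c_y)) ≤ σ ≤ 1∕1024`;
bi-contractive frames normalised at their centres with window rows `a₀ a₁`, `ℓa₀ ≤ c₀`, `ℓ²a₁ ≤ c₁`; `K₁ := (6 + 2c₀)·2σ ≤ 1∕256`, `K₂ := (2(c₁ + 2c₀²) + 24c₀ + 24)·2σ`.  THEN `∃ D‴`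
Hermitian-traceless with `ℓ·‖fun μ z => D‴ ⟨z,μ⟩‖ ≤ s₀ + (1+2s₀)(1+6σ)K₁`, `ℓ²·‖fun x => divB 𝒰 (fun μ z => D‴ ⟨z,μ⟩) x‖ ≤ s₁′ + d·(K₂ + 9K₁² + 36σK₂) + d·(6K₁s₀ + 4s₀(1+6σ)K₁)`,
`A((e^{iA₀}W)^u) = A(e^{iD‴}W)`, `e^{iD‴}W ∈ (6)(e) ∩ 𝔅_k(V)`.  [cite: Balaban1985RegularSpaces, (1.36) p.82, (1.72) p.88; Balaban1985Variational, Prop. 7 p.299, (15) p.280; Balaban1985BackgroundPropagators, (3.35) p.396] -/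
theorem exists_smoothUntwistedChart_socket_T3 (F : T3Family) {n K : ℕ} (h : n ≤ K) (hk1 : 1 ≤ K - n) {e s₀ s₁' σ a₀ a₁ c₀ c₁ : ℝ} (he : 0 ≤ e)
    {V : GaugeField (F.P n) 0 (Matrix.specialUnitaryGroup (Fin 2) ℂ)} (W : GaugeField (F.P K) 0 (Matrix.specialUnitaryGroup (Fin 2) ℂ))
    (A₀ : PBond (F.P K) 0 → Matrix (Fin 2) (Fin 2) ℂ) (hA0 : ∀ b, (A₀ b).IsHermitian ∧ Matrix.trace (A₀ b) = 0)
    (hs₀ : ((((F.P K).L ^ (K - n) : ℕ)) : ℝ) * ‖(fun (μ : Fin (F.P K).d) (z : Site (F.P K) 0) => A₀ ⟨z, μ⟩)‖ ≤ s₀) (hs₀' : s₀ ≤ 1 / 64)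
    (hs₁ : ((((F.P K).L ^ (K - n) : ℕ)) : ℝ) ^ 2 * ‖(fun x => divB (torusT (F.P K) 0) (fun κ z => unitsField (toUField W) ⟨z, κ⟩) (fun μ z => A₀ ⟨z, μ⟩) x)‖ ≤ s₁')
    (u : GaugeTransf (F.P K) 0 (Matrix.specialUnitaryGroup (Fin 2) ℂ)) (hXu : GaugeField.gaugeAct u (emb15 W (expHermField A₀)) ∈ regFibrePr F n K h e V)
    (hσ : ∀ y : Site (F.P K) (K - n), dist1 (u (embIter (K - n) y)) ≤ σ) (hσ0 : σ ≤ 1 / 1024) (hσc : ((6 + 2 * c₀) * (2 * σ)) ≤ 1 / 256)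
    (Fr : Site (F.P K) (K - n) → Site (F.P K) 0 → (Matrix (Fin 2) (Fin 2) ℂ)ˣ)
    (hFr : ∀ y z, ‖(Fr y z : Matrix (Fin 2) (Fin 2) ℂ)‖ ≤ 1 ∧ ‖(((Fr y z)⁻¹ : (Matrix (Fin 2) (Fin 2) ℂ)ˣ) : Matrix (Fin 2) (Fin 2) ℂ)‖ ≤ 1) (hFr1 : ∀ y, Fr y (embIter (K - n) y) = 1)
    (ha₀ : 0 ≤ a₀) (ha₁ : 0 ≤ a₁) (hc₀ : ((((F.P K).L ^ (K - n) : ℕ)) : ℝ) * a₀ ≤ c₀) (hc₁ : ((((F.P K).L ^ (K - n) : ℕ)) : ℝ) ^ 2 * a₁ ≤ c₁)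
    (hA : ∀ (y : Site (F.P K) (K - n)) (z : Site (F.P K) 0), (∀ ν : Fin (F.P K).d, (y ν = (iterBlockOf (K - n) (fun κ => z κ - (((((F.P K).L ^ (K - n) - 1) / 2 : ℕ)) : ZMod ((F.P K).sitesPerDir 0)))) ν - 1 ∨ y ν = (iterBlockOf (K - n) (fun κ => z κ - (((((F.P K).L ^ (K - n) - 1) / 2 : ℕ)) : ZMod ((F.P K).sitesPerDir 0)))) ν ∨ y ν = (iterBlockOf (K - n) (fun κ => z κ - (((((F.P K).L ^ (K - n) - 1) / 2 : ℕ)) : ZMod ((F.P K).sitesPerDir 0)))) ν + 1 ∨ y ν = (iterBlockOf (K - n) (fun κ => z κ - (((((F.P K).L ^ (K - n) - 1) / 2 : ℕ)) : ZMod ((F.P K).sitesPerDir 0)))) ν + 2)) → ∀ μ : Fin (F.P K).d,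
      ‖(((Fr y z)⁻¹ * unitsField (toUField W) ⟨z, μ⟩ * Fr y (torusT (F.P K) 0 μ z) : (Matrix (Fin 2) (Fin 2) ℂ)ˣ) : Matrix (Fin 2) (Fin 2) ℂ) - 1‖ ≤ a₀
      ∧ ‖(((Fr y ((torusT (F.P K) 0 μ).symm z))⁻¹ * unitsField (toUField W) ⟨(torusT (F.P K) 0 μ).symm z, μ⟩ * Fr y z : (Matrix (Fin 2) (Fin 2) ℂ)ˣ) : Matrix (Fin 2) (Fin 2) ℂ) - 1‖ ≤ a₀
      ∧ ‖(((Fr y z)⁻¹ * unitsField (toUField W) ⟨z, μ⟩ * Fr y (torusT (F.P K) 0 μ z) : (Matrix (Fin 2) (Fin 2) ℂ)ˣ) : Matrix (Fin 2) (Fin 2) ℂ)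
          - (((Fr y ((torusT (F.P K) 0 μ).symm z))⁻¹ * unitsField (toUField W) ⟨(torusT (F.P K) 0 μ).symm z, μ⟩ * Fr y z : (Matrix (Fin 2) (Fin 2) ℂ)ˣ) : Matrix (Fin 2) (Fin 2) ℂ)‖ ≤ a₁) :
    ∃ D : PBond (F.P K) 0 → Matrix (Fin 2) (Fin 2) ℂ,
      (∀ b, (D b).IsHermitian ∧ Matrix.trace (D b) = 0) ∧
      ((((F.P K).L ^ (K - n) : ℕ)) : ℝ) * ‖(fun (μ : Fin (F.P K).d) (z : Site (F.P K) 0) => D ⟨z, μ⟩)‖ ≤ s₀ + (1 + 2 * s₀) * ((1 + 6 * σ) * ((6 + 2 * c₀) * (2 * σ))) ∧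
      ((((F.P K).L ^ (K - n) : ℕ)) : ℝ) ^ 2 * ‖(fun x => divB (torusT (F.P K) 0) (fun κ z => unitsField (toUField W) ⟨z, κ⟩) (fun μ z => D ⟨z, μ⟩) x)‖
          ≤ s₁' + ((F.P K).d : ℝ) * (((2 * (c₁ + 2 * c₀ ^ 2) + 24 * c₀ + 24) * (2 * σ)) + 9 * ((6 + 2 * c₀) * (2 * σ)) ^ 2 + 36 * σ * ((2 * (c₁ + 2 * c₀ ^ 2) + 24 * c₀ + 24) * (2 * σ))) + ((F.P K).d : ℝ) * (6 * ((6 + 2 * c₀) * (2 * σ)) * s₀ + 4 * s₀ * ((1 + 6 * σ) * ((6 + 2 * c₀) * (2 * σ)))) ∧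
      wilsonAction4 (GaugeField.gaugeAct u (emb15 W (expHermField A₀))) = wilsonAction4 (emb15 W (expHermField D)) ∧
      emb15 W (expHermField D) ∈ regFibrePr F n K h e V := by
  have hL2 : 2 ≤ (F.P K).L := by have := (F.P K).hL.2; omega
  have hℓ2 : 2 ≤ (F.P K).L ^ (K - n) := hL2.trans (Nat.le_self_pow (by omega) _)
  have hℓ : (1 : ℝ) ≤ ((((F.P K).L ^ (K - n) : ℕ)) : ℝ) := by exact_mod_cast (le_trans (by norm_num) hℓ2)
  have hℓ0 : (0 : ℝ) < ((((F.P K).L ^ (K - n) : ℕ)) : ℝ) := by linarith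
  have hσnn : 0 ≤ σ := (GaugeGroup.dist1_nonneg _).trans (hσ (Classical.arbitrary _))
  have hc0nn : 0 ≤ c₀ := le_trans (by positivity) hc₀
  have hK1nn : 0 ≤ ((6 + 2 * c₀) * (2 * σ)) := by positivity
  -- pointwise sup of `A₀`: `s := ‖A₀‖_∞` with `ℓ·s ≤ s₀`
  have hs0nn : 0 ≤ s₀ := le_trans (by positivity) hs₀
  have hs : ∀ b : PBond (F.P K) 0, ‖A₀ b‖ ≤ ‖(fun (μ : Fin (F.P K).d) (z : Site (F.P K) 0) => A₀ ⟨z, μ⟩)‖ := by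
    rintro ⟨z, μ⟩; exact norm_bond_le_of_pi (fun (μ : Fin (F.P K).d) (z : Site (F.P K) 0) => A₀ ⟨z, μ⟩) μ z
  have hsup1 : ‖(fun (μ : Fin (F.P K).d) (z : Site (F.P K) 0) => A₀ ⟨z, μ⟩)‖ ≤ s₀ := by
    have := mul_le_mul_of_nonneg_left (norm_nonneg (fun (μ : Fin (F.P K).d) (z : Site (F.P K) 0) => A₀ ⟨z, μ⟩)) (by linarith : (0:ℝ) ≤ ((((F.P K).L ^ (K - n) : ℕ)) : ℝ) - 1)
    nlinarith
  have hs64 : ‖(fun (μ : Fin (F.P K).d) (z : Site (F.P K) 0) => A₀ ⟨z, μ⟩)‖ ≤ 1 / 64 := hsup1.trans hs₀'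
  obtain ⟨D, hD1, hD2, hD3, hD4, hD5⟩ := exists_smoothUntwistedChart_kUniform_T3 F h hk1 he W A₀ hA0 hs hs64 u hXu hσ hσ0 hσc Fr hFr hFr1 ha₀ ha₁ hc₀ hc₁ hA
  refine ⟨D, hD1, ?_, ?_, hD4, hD5⟩
  · -- sup row in the `Pi` norm
    have hrow : ∀ (μ : Fin (F.P K).d) (z : Site (F.P K) 0), ‖(fun (μ : Fin (F.P K).d) (z : Site (F.P K) 0) => D ⟨z, μ⟩) μ z‖
        ≤ (s₀ + (1 + 2 * s₀) * ((1 + 6 * σ) * ((6 + 2 * c₀) * (2 * σ)))) / ((((F.P K).L ^ (K - n) : ℕ)) : ℝ) := by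
      intro μ z
      rw [le_div_iff₀ hℓ0, mul_comm]
      refine (hD2 ⟨z, μ⟩).trans ?_
      have h1 : (1 + 2 * ‖(fun (μ : Fin (F.P K).d) (z : Site (F.P K) 0) => A₀ ⟨z, μ⟩)‖) * ((1 + 6 * σ) * ((6 + 2 * c₀) * (2 * σ))) ≤ (1 + 2 * s₀) * ((1 + 6 * σ) * ((6 + 2 * c₀) * (2 * σ))) :=
        mul_le_mul_of_nonneg_right (by linarith) (by positivity)
      linarith [hs₀]
    have hnn : 0 ≤ (s₀ + (1 + 2 * s₀) * ((1 + 6 * σ) * ((6 + 2 * c₀) * (2 * σ)))) / ((((F.P K).L ^ (K - n) : ℕ)) : ℝ) := by positivity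
    have := (pi_norm_bond_le_iff _ hnn).2 hrow
    rw [le_div_iff₀ hℓ0, mul_comm] at this
    exact this
  · -- divergence row in the `Pi` norm
    have hs₁pt : ∀ x, ((((F.P K).L ^ (K - n) : ℕ)) : ℝ) ^ 2 * ‖divB (torusT (F.P K) 0) (fun κ z => unitsField (toUField W) ⟨z, κ⟩) (fun μ z => A₀ ⟨z, μ⟩) x‖ ≤ s₁' := fun x =>
      (mul_le_mul_of_nonneg_left (norm_le_pi_norm (fun x => divB (torusT (F.P K) 0) (fun κ z => unitsField (toUField W) ⟨z, κ⟩) (fun μ z => A₀ ⟨z, μ⟩) x) x) (by positivity)).trans hs₁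
    have hℓs : ((((F.P K).L ^ (K - n) : ℕ)) : ℝ) * ‖(fun (μ : Fin (F.P K).d) (z : Site (F.P K) 0) => A₀ ⟨z, μ⟩)‖ ≤ s₀ := hs₀
    set R₀ : ℝ := s₁' + ((F.P K).d : ℝ) * (((2 * (c₁ + 2 * c₀ ^ 2) + 24 * c₀ + 24) * (2 * σ)) + 9 * ((6 + 2 * c₀) * (2 * σ)) ^ 2 + 36 * σ * ((2 * (c₁ + 2 * c₀ ^ 2) + 24 * c₀ + 24) * (2 * σ))) + ((F.P K).d : ℝ) * (6 * ((6 + 2 * c₀) * (2 * σ)) * s₀ + 4 * s₀ * ((1 + 6 * σ) * ((6 + 2 * c₀) * (2 * σ)))) with hR₀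
    have hrow : ∀ x, ‖(fun x => divB (torusT (F.P K) 0) (fun κ z => unitsField (toUField W) ⟨z, κ⟩) (fun μ z => D ⟨z, μ⟩) x) x‖ ≤ R₀ / ((((F.P K).L ^ (K - n) : ℕ)) : ℝ) ^ 2 := by
      intro x
      have hℓ20 : (0 : ℝ) < ((((F.P K).L ^ (K - n) : ℕ)) : ℝ) ^ 2 := by positivity
      rw [le_div_iff₀ hℓ20, mul_comm]
      refine (hD3 x).trans ?_
      have hn0 : 0 ≤ ‖(fun (μ : Fin (F.P K).d) (z : Site (F.P K) 0) => A₀ ⟨z, μ⟩)‖ := norm_nonneg _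
      have t1 : 6 * ((6 + 2 * c₀) * (2 * σ)) * (((((F.P K).L ^ (K - n) : ℕ)) : ℝ) * ‖(fun (μ : Fin (F.P K).d) (z : Site (F.P K) 0) => A₀ ⟨z, μ⟩)‖) ≤ 6 * ((6 + 2 * c₀) * (2 * σ)) * s₀ :=
        mul_le_mul_of_nonneg_left hℓs (by positivity)
      have t2 : 4 * (((((F.P K).L ^ (K - n) : ℕ)) : ℝ) * ‖(fun (μ : Fin (F.P K).d) (z : Site (F.P K) 0) => A₀ ⟨z, μ⟩)‖) * ((1 + 6 * σ) * ((6 + 2 * c₀) * (2 * σ))) ≤ 4 * s₀ * ((1 + 6 * σ) * ((6 + 2 * c₀) * (2 * σ))) :=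
        mul_le_mul_of_nonneg_right (by linarith) (by positivity)
      have hd0 : (0 : ℝ) ≤ ((F.P K).d : ℝ) := Nat.cast_nonneg _
      have t3 := mul_le_mul_of_nonneg_left (add_le_add t1 t2) hd0
      rw [hR₀]
      linarith [hs₁pt x, t3]
    have hR0nn : 0 ≤ R₀ / ((((F.P K).L ^ (K - n) : ℕ)) : ℝ) ^ 2 := le_trans (norm_nonneg _) (hrow (Classical.arbitrary _))
    have := (pi_norm_le_iff_of_nonneg hR0nn).2 hrow
    rw [le_div_iff₀ (by positivity), mul_comm] at this
    exact this

end Socket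

end Summit.QuantumFields.YangMills.Theorems.Prop7SmoothUntwistSocket

end
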